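import Literature.NumberTheory.EllipticCurves.KubertTateNineValuationsThree
import Literature.NumberTheory.EllipticCurves.ComplexMultiplicationRationalJIntegralProofs
import HarnessLib

/-!
# Kubert's `ℤ/9` family `E₉(f)`: the `j`-invariant at EVERY prime — poles of order `9·v_q` at the primes of
# `num(f)·den(f)·(num(f) − den(f))`, non-integrality of `j`, and «no complex multiplication»

Topic `NumberTheory/EllipticCurves`; continues `KubertTateNine` (universal property of `X₁(9)`: every curve with a
point of order `9` is `C • W = E₉(f) = E(f²(f-1)(f²-f+1), f²(f-1))`), `KubertTateNineInvariants` (the forms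
`A₃ = m³ - 3m²n + n³`, `P₉`, `Q = m² - mn + n²`, `L = m³ - 6m²n + 3mn² + n³` with `c₄ = A₃P₉/den¹²`,
`Δ = num⁹ (num - den)⁹ Q³ L/den²⁷`) and `KubertTateNineValuationsThree` (the prime `3`). THEOREMS ONLY (no
definition, no named fact, no `sorry`). Companion: `KubertTateNineBadPrimes` (reduction at those primes; `p = 3`).

## What is here (all unconditional)

* §1 (integer arithmetic) for a prime `q` and COPRIME `m, n`: if `q ∣ m·n·(m - n)` then `q` divides none of
  `A₃(m,n)`, `P₉(m,n)`, `Q(m,n)`, `L(m,n)` (each form is `a·G ± bᵈ` with `q ∣ a ∈ {m, n, m - n}`, `q ∤ b`):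
  `not_dvd_kubertNineA₃_of_dvd`, `…P₉…`, `…Q…`, `…L…`.
* §2 (over `ℚ`, `f = num/den ∉ {0, 1}`, any prime `q`): the GENERAL valuation formulas
  `v_q(c₄(E₉ f)) = v_q(A₃P₉(num, den)) - 12·v_q(den)`,
  `v_q(Δ(E₉ f)) = 9·v_q(num) + 9·v_q(num - den) + 3·v_q(Q) + v_q(L) - 27·v_q(den)`
  (`padicValRat_kubertTate_nine_c₄`, `padicValRat_kubertTate_nine_Δ`), and at a prime `q ∣ num·den·(num - den)`:
  `v_q(c₄) = -12·v_q(den)`, `v_q(Δ) = 9·(v_q(num) + v_q(num - den)) - 27·v_q(den)`; such a prime always exists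
  (`|num·den·(num - den)| ≥ 2`).
* §3 (the `j`-invariant of a curve with a point of order `9`) for `W/ℚ` elliptic with `C • W = E₉(f)`:
  `j(W) = c₄(E₉ f)³/Δ(E₉ f)` and, at every prime `q ∣ num·den·(num - den)`,
  **`v_q(j(W)) = -9·v_q(num·den·(num - den)) ≤ -9`** (`padicValRat_j_of_smul_eq_kubertTate_nine_of_dvd`) — the
  three cusps `f = 0, 1, ∞` of `X₁(9)` have ramification index `9` over `j = ∞` — so **`j(W) ∉ ℤ`: some
  `‖j(W)‖_q > 1`** (`exists_prime_one_lt_norm_j_of_smul_eq_kubertTate_nine`, `…_of_addOrderOf_eq_nine`), hence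
  **no elliptic curve over `ℚ` with a rational point of order `9` has complex multiplication**
  (`not_hasCM_of_addOrderOf_eq_nine`, through the tree's `not_hasCM_of_one_lt_norm_j`: CM `j`-invariants over
  `ℚ` are integers, Silverman *ATAEC* II.6.1 — the CM torsion table is not used).

In print: Kubert 1976 Table 3 (`N = 9`); Barrios–Roy 2022 §3.5 Case 3 ("`E_{C₉}` has additive reduction at a
prime `p` iff `p = 3` with `v₃(a + b) ≥ 1`", their `E_{C₉}(a, b)` being `E₉(b/a)` rescaled, Table 2 with
`a₁ = a³ + ab² - b³`), so at the primes of `ab(a - b)` the reduction is multiplicative; Silverman *AEC* VII.5.1(b),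
VII.5.5 (`v(j) < 0` iff potentially multiplicative), App. C §11 and *ATAEC* II.6.1 (CM `j`-invariants are integral).

References: [Kubert1976] Table 3; [BarriosRoy2022LocalData] Thm. 3.8 (table, row `C₉`) and §3.5 Case 3
(arXiv:2104.10337 pp. 18–20); [SilvermanAEC2009] Prop. VII.5.1, Prop. VII.5.5, App. C §11; [SilvermanATAEC1994]
Thm. II.6.1.
-/

noncomputable section

open scoped Classical

namespace WeierstrassCurve

/-! ### §0 Tools -/

section Tools

variable {q : ℕ} [hq : Fact q.Prime]

/-- `v_q(zⁿ) = n·v_q(z)`. [folklore] -/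
private theorem padicValInt_pow_eq (z : ℤ) (n : ℕ) : padicValInt q (z ^ n) = n * padicValInt q z := by
  simp [padicValInt, Int.natAbs_pow, padicValNat.pow]

/-- `v_q((Z : ℚ)/dᵏ) = v_q(Z) - k·v_q(d)`. [folklore] -/
private theorem padicValRat_intCast_div_natCast_pow' {Z : ℤ} (hZ : Z ≠ 0) {d : ℕ} (hd : d ≠ 0) (k : ℕ) :
    padicValRat q ((Z : ℚ) / (d : ℚ) ^ k) = (padicValInt q Z : ℤ) - k * (padicValNat q d : ℤ) := by
  rw [padicValRat.div (by exact_mod_cast hZ) (pow_ne_zero _ (by exact_mod_cast hd)), padicValRat.pow,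
    padicValRat.of_int, padicValRat.of_nat]

omit hq in
/-- `q ∤ X ⟹ X ≠ 0`. [folklore] -/
private theorem ne_zero_of_not_dvd' {X : ℤ} (h : ¬ (q : ℤ) ∣ X) : X ≠ 0 := by
  rintro rfl
  exact h (dvd_zero _)

/-- `q ∣ a`, `q ∤ b`, `X = a·G + bᵈ ⟹ q ∤ X` (`q` prime). [folklore] -/
private theorem not_dvd_of_eq_mul_add_pow {a b G X : ℤ} (ha : (q : ℤ) ∣ a) (hb : ¬ (q : ℤ) ∣ b) (d : ℕ)
    (hX : X = a * G + b ^ d) : ¬ (q : ℤ) ∣ X := fun h => by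
  rw [hX] at h
  exact hb ((Nat.prime_iff_prime_int.mp hq.out).dvd_of_dvd_pow ((dvd_add_right (dvd_mul_of_dvd_left ha G)).mp h))

/-- `q ∣ a`, `q ∤ b`, `X = a·G - bᵈ ⟹ q ∤ X` (`q` prime). [folklore] -/
private theorem not_dvd_of_eq_mul_sub_pow {a b G X : ℤ} (ha : (q : ℤ) ∣ a) (hb : ¬ (q : ℤ) ∣ b) (d : ℕ)
    (hX : X = a * G - b ^ d) : ¬ (q : ℤ) ∣ X := fun h => by
  rw [hX] at h
  exact hb ((Nat.prime_iff_prime_int.mp hq.out).dvd_of_dvd_pow ((dvd_sub_right (dvd_mul_of_dvd_left ha G)).mp h))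

/-- `1 ≤ v_q(z)` for `q ∣ z ≠ 0`. [folklore] -/
private theorem one_le_padicValInt_of_dvd {z : ℤ} (hz : z ≠ 0) (h : (q : ℤ) ∣ z) : 1 ≤ padicValInt q z := by
  have h' : (q : ℤ) ^ 1 ∣ z := by rwa [pow_one]
  rcases (padicValInt_dvd_iff (p := q) 1 z).mp h' with h0 | h1
  · exact absurd h0 hz
  · exact h1

/-- `v_q(x) < 0 ⟹ ‖x‖_q > 1` for a rational `x`. [folklore] -/
private theorem one_lt_padicNorm_of_padicValRat_lt_zero {x : ℚ} (hx : x ≠ 0) (hv : padicValRat q x < 0) :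
    1 < ‖(x : ℚ_[q])‖ := by
  rw [Padic.eq_padicNorm, padicNorm.eq_zpow_of_nonzero hx]
  have hq1 : (1 : ℚ) < q := by exact_mod_cast hq.out.one_lt
  exact_mod_cast one_lt_zpow₀ hq1 (by omega)

end Tools

/-! ### §1 The forms `A₃, P₉, Q, L` are units at every prime of `m·n·(m - n)` (coprime `m, n`) -/

section IntArith

variable {q : ℕ} [hq : Fact q.Prime] {m n : ℤ}

/-- For coprime `m, n` and a prime `q ∣ m·n·(m - n)`: `q ∣ m` (then `q ∤ n`), or `q ∣ n` (then `q ∤ m`), or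
`q ∣ m - n` (then `q ∤ m`, `q ∤ n`). [folklore] -/
private theorem dvd_cases_of_isCoprime_of_dvd_mul_mul_sub (hcop : IsCoprime m n) (h : (q : ℤ) ∣ m * n * (m - n)) :
    ((q : ℤ) ∣ m ∧ ¬ (q : ℤ) ∣ n) ∨ ((q : ℤ) ∣ n ∧ ¬ (q : ℤ) ∣ m) ∨
      ((q : ℤ) ∣ m - n ∧ ¬ (q : ℤ) ∣ m ∧ ¬ (q : ℤ) ∣ n) := by
  have hqp : Prime (q : ℤ) := Nat.prime_iff_prime_int.mp hq.out
  have hnot : ¬ ((q : ℤ) ∣ m ∧ (q : ℤ) ∣ n) := fun ⟨hm, hn⟩ => by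
    have hu := hcop.isUnit_of_dvd' hm hn
    rw [Int.isUnit_iff] at hu
    have h1 := hq.out.one_lt
    omega
  rcases hqp.dvd_or_dvd h with hmn | hsub
  · rcases hqp.dvd_or_dvd hmn with hm | hn
    · exact Or.inl ⟨hm, fun hn => hnot ⟨hm, hn⟩⟩
    · exact Or.inr (Or.inl ⟨hn, fun hm => hnot ⟨hm, hn⟩⟩)
  · refine Or.inr (Or.inr ⟨hsub, fun hm => ?_, fun hn => ?_⟩)
    · exact hnot ⟨hm, by simpa using dvd_sub hm hsub⟩
    · exact hnot ⟨by simpa using dvd_add hsub hn, hn⟩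

/-- **`q ∤ A₃(m, n) = m³ - 3m²n + n³`** for coprime `m, n` and a prime `q ∣ m·n·(m - n)`
(`A₃ = m(m² - 3mn) + n³ = n(n² - 3m²) + m³ = (m - n)(m² - 2mn - 2n²) - n³`). [cite: Kubert1976, Table 3 (N = 9)] -/
theorem not_dvd_kubertNineA₃_of_dvd (hcop : IsCoprime m n) (h : (q : ℤ) ∣ m * n * (m - n)) :
    ¬ (q : ℤ) ∣ m ^ 3 - 3 * m ^ 2 * n + n ^ 3 := by
  rcases dvd_cases_of_isCoprime_of_dvd_mul_mul_sub hcop h with ⟨ha, hb⟩ | ⟨ha, hb⟩ | ⟨ha, -, hb⟩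
  · exact not_dvd_of_eq_mul_add_pow ha hb 3 (G := m ^ 2 - 3 * m * n) (by ring)
  · exact not_dvd_of_eq_mul_add_pow ha hb 3 (G := n ^ 2 - 3 * m ^ 2) (by ring)
  · exact not_dvd_of_eq_mul_sub_pow ha hb 3 (G := m ^ 2 - 2 * m * n - 2 * n ^ 2) (by ring)

/-- **`q ∤ P₉(m, n)`** (the nonic cofactor of `c₄`) for coprime `m, n` and a prime `q ∣ m·n·(m - n)`
(`P₉ ≡ n⁹ (mod m)`, `≡ m⁹ (mod n)`, `≡ -n⁹ (mod m - n)`). [cite: Kubert1976, Table 3 (N = 9)] -/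
theorem not_dvd_kubertNineP₉_of_dvd (hcop : IsCoprime m n) (h : (q : ℤ) ∣ m * n * (m - n)) :
    ¬ (q : ℤ) ∣ m ^ 9 - 9 * m ^ 8 * n + 27 * m ^ 7 * n ^ 2 - 48 * m ^ 6 * n ^ 3 + 54 * m ^ 5 * n ^ 4
        - 45 * m ^ 4 * n ^ 5 + 27 * m ^ 3 * n ^ 6 - 9 * m ^ 2 * n ^ 7 + n ^ 9 := by
  rcases dvd_cases_of_isCoprime_of_dvd_mul_mul_sub hcop h with ⟨ha, hb⟩ | ⟨ha, hb⟩ | ⟨ha, -, hb⟩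
  · exact not_dvd_of_eq_mul_add_pow ha hb 9
      (G := m ^ 8 - 9 * m ^ 7 * n + 27 * m ^ 6 * n ^ 2 - 48 * m ^ 5 * n ^ 3 + 54 * m ^ 4 * n ^ 4
        - 45 * m ^ 3 * n ^ 5 + 27 * m ^ 2 * n ^ 6 - 9 * m * n ^ 7) (by ring)
  · exact not_dvd_of_eq_mul_add_pow ha hb 9
      (G := -9 * m ^ 8 + 27 * m ^ 7 * n - 48 * m ^ 6 * n ^ 2 + 54 * m ^ 5 * n ^ 3 - 45 * m ^ 4 * n ^ 4
        + 27 * m ^ 3 * n ^ 5 - 9 * m ^ 2 * n ^ 6 + n ^ 8) (by ring)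
  · exact not_dvd_of_eq_mul_sub_pow ha hb 9
      (G := m ^ 8 - 8 * m ^ 7 * n + 19 * m ^ 6 * n ^ 2 - 29 * m ^ 5 * n ^ 3 + 25 * m ^ 4 * n ^ 4
        - 20 * m ^ 3 * n ^ 5 + 7 * m ^ 2 * n ^ 6 - 2 * m * n ^ 7 - 2 * n ^ 8) (by ring)

/-- **`q ∤ Q(m, n) = m² - mn + n²`** for coprime `m, n` and a prime `q ∣ m·n·(m - n)`
(`Q = m(m - n) + n² = n(n - m) + m² = (m - n)·m + n²`). [cite: Kubert1976, Table 3 (N = 9)] -/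
theorem not_dvd_kubertNineQ_of_dvd (hcop : IsCoprime m n) (h : (q : ℤ) ∣ m * n * (m - n)) :
    ¬ (q : ℤ) ∣ m ^ 2 - m * n + n ^ 2 := by
  rcases dvd_cases_of_isCoprime_of_dvd_mul_mul_sub hcop h with ⟨ha, hb⟩ | ⟨ha, hb⟩ | ⟨ha, -, hb⟩
  · exact not_dvd_of_eq_mul_add_pow ha hb 2 (G := m - n) (by ring)
  · exact not_dvd_of_eq_mul_add_pow ha hb 2 (G := n - m) (by ring)
  · exact not_dvd_of_eq_mul_add_pow ha hb 2 (G := m) (by ring)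

/-- **`q ∤ L(m, n) = m³ - 6m²n + 3mn² + n³`** for coprime `m, n` and a prime `q ∣ m·n·(m - n)`
(`L = m(m² - 6mn + 3n²) + n³ = n(-6m² + 3mn + n²) + m³ = (m - n)(m² - 5mn - 2n²) - n³`).
[cite: Kubert1976, Table 3 (N = 9)] -/
theorem not_dvd_kubertNineL_of_dvd (hcop : IsCoprime m n) (h : (q : ℤ) ∣ m * n * (m - n)) :
    ¬ (q : ℤ) ∣ m ^ 3 - 6 * m ^ 2 * n + 3 * m * n ^ 2 + n ^ 3 := by
  rcases dvd_cases_of_isCoprime_of_dvd_mul_mul_sub hcop h with ⟨ha, hb⟩ | ⟨ha, hb⟩ | ⟨ha, -, hb⟩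
  · exact not_dvd_of_eq_mul_add_pow ha hb 3 (G := m ^ 2 - 6 * m * n + 3 * n ^ 2) (by ring)
  · exact not_dvd_of_eq_mul_add_pow ha hb 3 (G := -6 * m ^ 2 + 3 * m * n + n ^ 2) (by ring)
  · exact not_dvd_of_eq_mul_sub_pow ha hb 3 (G := m ^ 2 - 5 * m * n - 2 * n ^ 2) (by ring)

end IntArith

/-! ### §2 The `q`-adic valuations of `c₄(E₉ f)` and `Δ(E₉ f)`, `f ∈ ℚ`, at any prime `q` -/

section Valuations

variable {q : ℕ} [hq : Fact q.Prime] (f : ℚ)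

/-- `num(f)` and `den(f)` are coprime. [folklore] -/
private theorem isCoprime_num_den : IsCoprime f.num (f.den : ℤ) := by
  rw [Int.isCoprime_iff_gcd_eq_one]
  exact f.reduced

/-- `f ≠ 1 ⟹ num(f) - den(f) ≠ 0`. [folklore] -/
private theorem num_sub_den_ne_zero (hf1 : f ≠ 1) : f.num - f.den ≠ 0 := by
  intro h0
  apply hf1
  have h1 : f.num = f.den := by omega
  rw [← Rat.num_div_den f, h1]
  exact div_self (by exact_mod_cast f.den_ne_zero)

/-- **`v_q(c₄(E₉ f)) = v_q(A₃(num,den)·P₉(num,den)) - 12·v_q(den f)`** at any prime `q`, provided the numerator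
form is nonzero (it always is, `kubertTate_nine_c₄_ne_zero`). [cite: Kubert1976, Table 3 (N = 9)] -/
theorem padicValRat_kubertTate_nine_c₄
    (hN : (f.num ^ 3 - 3 * f.num ^ 2 * f.den + (f.den : ℤ) ^ 3) *
          (f.num ^ 9 - 9 * f.num ^ 8 * f.den + 27 * f.num ^ 7 * (f.den : ℤ) ^ 2
            - 48 * f.num ^ 6 * (f.den : ℤ) ^ 3 + 54 * f.num ^ 5 * (f.den : ℤ) ^ 4
            - 45 * f.num ^ 4 * (f.den : ℤ) ^ 5 + 27 * f.num ^ 3 * (f.den : ℤ) ^ 6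
            - 9 * f.num ^ 2 * (f.den : ℤ) ^ 7 + (f.den : ℤ) ^ 9) ≠ 0) :
    padicValRat q (kubertTate (f ^ 2 * (f - 1) * (f ^ 2 - f + 1)) (f ^ 2 * (f - 1))).c₄ =
      (padicValInt q ((f.num ^ 3 - 3 * f.num ^ 2 * f.den + (f.den : ℤ) ^ 3) *
          (f.num ^ 9 - 9 * f.num ^ 8 * f.den + 27 * f.num ^ 7 * (f.den : ℤ) ^ 2
            - 48 * f.num ^ 6 * (f.den : ℤ) ^ 3 + 54 * f.num ^ 5 * (f.den : ℤ) ^ 4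
            - 45 * f.num ^ 4 * (f.den : ℤ) ^ 5 + 27 * f.num ^ 3 * (f.den : ℤ) ^ 6
            - 9 * f.num ^ 2 * (f.den : ℤ) ^ 7 + (f.den : ℤ) ^ 9)) : ℤ) - 12 * (padicValNat q f.den : ℤ) := by
  rw [kubertTate_nine_c₄_eq_num_den, padicValRat_intCast_div_natCast_pow' hN f.den_ne_zero]
  push_cast
  ring

/-- **`v_q(Δ(E₉ f)) = 9·v_q(num) + 9·v_q(num - den) + 3·v_q(Q(num,den)) + v_q(L(num,den)) - 27·v_q(den)`** at any
prime `q`, for `f ∉ {0, 1}` and `Q(num,den), L(num,den) ≠ 0`. [cite: Kubert1976, Table 3 (N = 9)] -/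
theorem padicValRat_kubertTate_nine_Δ (hf0 : f ≠ 0) (hf1 : f ≠ 1)
    (hQ : f.num ^ 2 - f.num * f.den + (f.den : ℤ) ^ 2 ≠ 0)
    (hL : f.num ^ 3 - 6 * f.num ^ 2 * f.den + 3 * f.num * (f.den : ℤ) ^ 2 + (f.den : ℤ) ^ 3 ≠ 0) :
    padicValRat q (kubertTate (f ^ 2 * (f - 1) * (f ^ 2 - f + 1)) (f ^ 2 * (f - 1))).Δ =
      9 * (padicValInt q f.num : ℤ) + 9 * (padicValInt q (f.num - f.den) : ℤ)
        + 3 * (padicValInt q (f.num ^ 2 - f.num * f.den + (f.den : ℤ) ^ 2) : ℤ)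
        + (padicValInt q (f.num ^ 3 - 6 * f.num ^ 2 * f.den + 3 * f.num * (f.den : ℤ) ^ 2 + (f.den : ℤ) ^ 3) : ℤ)
        - 27 * (padicValNat q f.den : ℤ) := by
  have hm0 : f.num ≠ 0 := Rat.num_ne_zero.mpr hf0
  have hmn0 := num_sub_den_ne_zero f hf1
  rw [kubertTate_nine_Δ_eq_num_den, padicValRat_intCast_div_natCast_pow'
    (mul_ne_zero (mul_ne_zero (mul_ne_zero (pow_ne_zero _ hm0) (pow_ne_zero _ hmn0))
      (pow_ne_zero _ hQ)) hL) f.den_ne_zero,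
    padicValInt.mul (mul_ne_zero (mul_ne_zero (pow_ne_zero _ hm0) (pow_ne_zero _ hmn0))
      (pow_ne_zero _ hQ)) hL,
    padicValInt.mul (mul_ne_zero (pow_ne_zero _ hm0) (pow_ne_zero _ hmn0)) (pow_ne_zero _ hQ),
    padicValInt.mul (pow_ne_zero _ hm0) (pow_ne_zero _ hmn0),
    padicValInt_pow_eq, padicValInt_pow_eq, padicValInt_pow_eq]
  push_cast
  ring

/-- **At a prime `q ∣ num·den·(num - den)`: `v_q(c₄(E₉ f)) = -12·v_q(den f)`** (the numerator form `A₃P₉` is a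
`q`-adic unit, §1). [cite: Kubert1976, Table 3 (N = 9)] [cite: BarriosRoy2022LocalData, §3.5 Case 3] -/
theorem padicValRat_kubertTate_nine_c₄_of_dvd (h : (q : ℤ) ∣ f.num * f.den * (f.num - f.den)) :
    padicValRat q (kubertTate (f ^ 2 * (f - 1) * (f ^ 2 - f + 1)) (f ^ 2 * (f - 1))).c₄ =
      -12 * (padicValNat q f.den : ℤ) := by
  have hA := not_dvd_kubertNineA₃_of_dvd (isCoprime_num_den f) h
  have hP := not_dvd_kubertNineP₉_of_dvd (isCoprime_num_den f) h
  rw [padicValRat_kubertTate_nine_c₄ f (mul_ne_zero (ne_zero_of_not_dvd' hA) (ne_zero_of_not_dvd' hP)),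
    padicValInt.mul (ne_zero_of_not_dvd' hA) (ne_zero_of_not_dvd' hP), padicValInt.eq_zero_of_not_dvd hA,
    padicValInt.eq_zero_of_not_dvd hP]
  push_cast
  ring

/-- **At a prime `q ∣ num·den·(num - den)` (`f ∉ {0,1}`):
`v_q(Δ(E₉ f)) = 9·(v_q(num f) + v_q(num f - den f)) - 27·v_q(den f)`** (`Q`, `L` are `q`-adic units, §1).
[cite: Kubert1976, Table 3 (N = 9)] [cite: BarriosRoy2022LocalData, §3.5 Case 3] -/
theorem padicValRat_kubertTate_nine_Δ_of_dvd (hf0 : f ≠ 0) (hf1 : f ≠ 1)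
    (h : (q : ℤ) ∣ f.num * f.den * (f.num - f.den)) :
    padicValRat q (kubertTate (f ^ 2 * (f - 1) * (f ^ 2 - f + 1)) (f ^ 2 * (f - 1))).Δ =
      9 * ((padicValInt q f.num : ℤ) + (padicValInt q (f.num - f.den) : ℤ)) - 27 * (padicValNat q f.den : ℤ) := by
  have hQ := not_dvd_kubertNineQ_of_dvd (isCoprime_num_den f) h
  have hL := not_dvd_kubertNineL_of_dvd (isCoprime_num_den f) h
  rw [padicValRat_kubertTate_nine_Δ f hf0 hf1 (ne_zero_of_not_dvd' hQ) (ne_zero_of_not_dvd' hL),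
    padicValInt.eq_zero_of_not_dvd hQ, padicValInt.eq_zero_of_not_dvd hL]
  push_cast
  ring

/-- `v_q(num·den·(num - den)) = v_q(num) + v_q(den) + v_q(num - den)` (`f ∉ {0,1}`). [folklore] -/
private theorem padicValInt_num_mul_den_mul_sub (hf0 : f ≠ 0) (hf1 : f ≠ 1) :
    padicValInt q (f.num * f.den * (f.num - f.den)) =
      padicValInt q f.num + padicValNat q f.den + padicValInt q (f.num - f.den) := by
  have hm0 : f.num ≠ 0 := Rat.num_ne_zero.mpr hf0
  have hd0 : (f.den : ℤ) ≠ 0 := by exact_mod_cast f.den_ne_zero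
  rw [padicValInt.mul (mul_ne_zero hm0 hd0) (num_sub_den_ne_zero f hf1), padicValInt.mul hm0 hd0,
    padicValInt.of_nat]

/-- **A prime of `num·den·(num - den)` always exists** for `f ∉ {0, 1}`: `|num·den·(num - den)| ≥ 2`
(`num = ±1`, `den = 1` forces `num - den ∈ {0, -2}`). [folklore] -/
private theorem exists_prime_dvd_num_mul_den_mul_sub (hf0 : f ≠ 0) (hf1 : f ≠ 1) :
    ∃ q : ℕ, q.Prime ∧ (q : ℤ) ∣ f.num * f.den * (f.num - f.den) := by
  have hm0 : f.num ≠ 0 := Rat.num_ne_zero.mpr hf0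
  have hmn0 := num_sub_den_ne_zero f hf1
  have hne : (f.num * f.den * (f.num - f.den)).natAbs ≠ 1 := by
    intro h1
    rw [Int.natAbs_mul, Int.natAbs_mul, Int.natAbs_natCast] at h1
    have hd1 : f.den = 1 := Nat.eq_one_of_mul_eq_one_left (Nat.eq_one_of_mul_eq_one_right h1)
    have hn1 : f.num.natAbs = 1 := Nat.eq_one_of_mul_eq_one_right (Nat.eq_one_of_mul_eq_one_right h1)
    have hs1 : (f.num - f.den).natAbs = 1 := Nat.eq_one_of_mul_eq_one_left h1
    rcases Int.natAbs_eq_iff.mp hn1 with h | h <;> rcases Int.natAbs_eq_iff.mp hs1 with h' | h' <;>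
      simp only [hd1, Nat.cast_one] at h h' <;> omega
  obtain ⟨p, hp, hpd⟩ := Int.exists_prime_and_dvd hne
  refine ⟨p.natAbs, Int.prime_iff_natAbs_prime.mp hp, ?_⟩
  exact Int.natAbs_dvd.mpr hpd

end Valuations

/-! ### §3 The `j`-invariant of a curve with a rational point of order `9` -/

section JInvariant

variable {W : WeierstrassCurve ℚ} [W.IsElliptic] {f : ℚ} {C : VariableChange ℚ}

/-- In Kubert's chart `C • W = E₉(f)` of an elliptic curve: `f ∉ {0, 1}` (`Δ(E₉ f) = Δ(C • W) ≠ 0`).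
[cite: Kubert1976, Table 3 (N = 9)] -/
theorem ne_zero_and_ne_one_of_smul_eq_kubertTate_nine
    (hC : C • W = kubertTate (f ^ 2 * (f - 1) * (f ^ 2 - f + 1)) (f ^ 2 * (f - 1))) : f ≠ 0 ∧ f ≠ 1 := by
  apply kubertTate_nine_ne_zero_and_ne_one_of_Δ_ne_zero
  rw [← hC]
  exact (C • W).isUnit_Δ.ne_zero

/-- **`j(W) = c₄(E₉ f)³ / Δ(E₉ f)`** for `C • W = E₉(f)` (`j` is invariant under `C`, Mathlib `variableChange_j`).
[cite: Kubert1976, Table 3 (N = 9)] -/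
theorem j_eq_of_smul_eq_kubertTate_nine
    (hC : C • W = kubertTate (f ^ 2 * (f - 1) * (f ^ 2 - f + 1)) (f ^ 2 * (f - 1))) :
    W.j = (kubertTate (f ^ 2 * (f - 1) * (f ^ 2 - f + 1)) (f ^ 2 * (f - 1))).c₄ ^ 3 /
      (kubertTate (f ^ 2 * (f - 1) * (f ^ 2 - f + 1)) (f ^ 2 * (f - 1))).Δ := by
  have h1 : (C • W).j = (C • W).c₄ ^ 3 / (C • W).Δ := by
    rw [j, ← coe_Δ', Units.val_inv_eq_inv_val]; ring
  rw [← variableChange_j W C, h1, hC]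

/-- **The pole of `j` at a prime of `num·den·(num - den)`.** For `W/ℚ` elliptic with `C • W = E₉(f)` and a prime
`q ∣ num(f)·den(f)·(num(f) - den(f))`: **`v_q(j(W)) = -9·v_q(num·den·(num - den))`** — the cusps `0, 1, ∞` of
`X₁(9)` are ramified of index `9` over `j = ∞` (`3·(-12e) - (9a + 9b - 27e) = -9(a + b + e)`).
[cite: Kubert1976, Table 3 (N = 9)] [cite: BarriosRoy2022LocalData, §3.5 Case 3] [cite: SilvermanAEC2009, Prop. VII.5.1(b)] -/
theorem padicValRat_j_of_smul_eq_kubertTate_nine_of_dvd {q : ℕ} [Fact q.Prime]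
    (hC : C • W = kubertTate (f ^ 2 * (f - 1) * (f ^ 2 - f + 1)) (f ^ 2 * (f - 1)))
    (h : (q : ℤ) ∣ f.num * f.den * (f.num - f.den)) :
    padicValRat q W.j = -9 * (padicValInt q (f.num * f.den * (f.num - f.den)) : ℤ) := by
  obtain ⟨hf0, hf1⟩ := ne_zero_and_ne_one_of_smul_eq_kubertTate_nine hC
  have hΔ : (kubertTate (f ^ 2 * (f - 1) * (f ^ 2 - f + 1)) (f ^ 2 * (f - 1))).Δ ≠ 0 := by
    rw [← hC]; exact (C • W).isUnit_Δ.ne_zero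
  rw [j_eq_of_smul_eq_kubertTate_nine hC, padicValRat.div (pow_ne_zero _ (kubertTate_nine_c₄_ne_zero f)) hΔ,
    padicValRat.pow, padicValRat_kubertTate_nine_c₄_of_dvd f h,
    padicValRat_kubertTate_nine_Δ_of_dvd f hf0 hf1 h, padicValInt_num_mul_den_mul_sub f hf0 hf1]
  push_cast
  ring

/-- **Hence `v_q(j(W)) ≤ -9 < 0` at every prime `q ∣ num·den·(num - den)`.**
[cite: Kubert1976, Table 3 (N = 9)] [cite: SilvermanAEC2009, Prop. VII.5.1(b)] -/
theorem padicValRat_j_le_of_smul_eq_kubertTate_nine_of_dvd {q : ℕ} [Fact q.Prime]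
    (hC : C • W = kubertTate (f ^ 2 * (f - 1) * (f ^ 2 - f + 1)) (f ^ 2 * (f - 1)))
    (h : (q : ℤ) ∣ f.num * f.den * (f.num - f.den)) : padicValRat q W.j ≤ -9 := by
  obtain ⟨hf0, hf1⟩ := ne_zero_and_ne_one_of_smul_eq_kubertTate_nine hC
  have h1 := one_le_padicValInt_of_dvd (q := q)
    (mul_ne_zero (mul_ne_zero (Rat.num_ne_zero.mpr hf0) (by exact_mod_cast f.den_ne_zero))
      (num_sub_den_ne_zero f hf1)) h
  rw [padicValRat_j_of_smul_eq_kubertTate_nine_of_dvd hC h]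
  linarith

/-- **`‖j(W)‖_q > 1` at every prime `q ∣ num·den·(num - den)`** (`W` with `C • W = E₉(f)`).
[cite: SilvermanAEC2009, Prop. VII.5.1(b) and Prop. VII.5.5] -/
theorem one_lt_norm_j_of_smul_eq_kubertTate_nine_of_dvd {q : ℕ} [Fact q.Prime]
    (hC : C • W = kubertTate (f ^ 2 * (f - 1) * (f ^ 2 - f + 1)) (f ^ 2 * (f - 1)))
    (h : (q : ℤ) ∣ f.num * f.den * (f.num - f.den)) : 1 < ‖(W.j : ℚ_[q])‖ := by
  have hv := padicValRat_j_le_of_smul_eq_kubertTate_nine_of_dvd hC h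
  have hj0 : W.j ≠ 0 := by
    intro h0
    rw [h0, padicValRat.zero] at hv
    linarith
  exact one_lt_padicNorm_of_padicValRat_lt_zero hj0 (by linarith)

/-- **The `j`-invariant of a curve with a rational point of order `9` is never integral: some `‖j(W)‖_q > 1`.**
(`W/ℚ` elliptic, `C • W = E₉(f)`; take any prime of `num·den·(num - den)`, `exists_prime_dvd_num_mul_den_mul_sub`.)
[cite: Kubert1976, Table 3 (N = 9)] [cite: SilvermanAEC2009, Prop. VII.5.5] -/
theorem exists_prime_one_lt_norm_j_of_smul_eq_kubertTate_nine
    (hC : C • W = kubertTate (f ^ 2 * (f - 1) * (f ^ 2 - f + 1)) (f ^ 2 * (f - 1))) :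
    ∃ (q : ℕ) (_ : Fact q.Prime), (q : ℤ) ∣ f.num * f.den * (f.num - f.den) ∧
      padicValRat q W.j ≤ -9 ∧ 1 < ‖(W.j : ℚ_[q])‖ := by
  obtain ⟨hf0, hf1⟩ := ne_zero_and_ne_one_of_smul_eq_kubertTate_nine hC
  obtain ⟨q, hq, hqd⟩ := exists_prime_dvd_num_mul_den_mul_sub f hf0 hf1
  haveI : Fact q.Prime := ⟨hq⟩
  exact ⟨q, ‹_›, hqd, padicValRat_j_le_of_smul_eq_kubertTate_nine_of_dvd hC hqd,
    one_lt_norm_j_of_smul_eq_kubertTate_nine_of_dvd hC hqd⟩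

/-- **No curve of Kubert's `ℤ/9` family has complex multiplication** (`C • W = E₉(f)` ⟹ `¬ W.HasCM`): CM
`j`-invariants over `ℚ` are integers (the tree's `not_hasCM_of_one_lt_norm_j`, Silverman *ATAEC* Thm. II.6.1),
`j(W)` is not. [cite: SilvermanATAEC1994, Thm. II.6.1] [cite: SilvermanAEC2009, App. C §11 and Prop. VII.5.5] -/
theorem not_hasCM_of_smul_eq_kubertTate_nine
    (hC : C • W = kubertTate (f ^ 2 * (f - 1) * (f ^ 2 - f + 1)) (f ^ 2 * (f - 1))) : ¬ W.HasCM := by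
  obtain ⟨q, hq, -, -, hnorm⟩ := exists_prime_one_lt_norm_j_of_smul_eq_kubertTate_nine hC
  exact not_hasCM_of_one_lt_norm_j W hnorm

variable (W) in
/-- **An elliptic curve over `ℚ` with a rational point of order `9` has non-integral `j`-invariant**: there is a
prime `q` with `v_q(j(W)) ≤ -9`, `‖j(W)‖_q > 1` (Kubert's chart `exists_kubertTate_nine_of_addOrderOf_eq_nine` + the
pole computation above). In particular it is potentially multiplicative somewhere (Silverman *AEC* VII.5.5).
[cite: Kubert1976, Table 3 (N = 9)] [cite: SilvermanAEC2009, Prop. VII.5.5] -/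
theorem exists_prime_one_lt_norm_j_of_addOrderOf_eq_nine {P : W.toAffine.Point} (hP : addOrderOf P = 9) :
    ∃ (q : ℕ) (_ : Fact q.Prime), padicValRat q W.j ≤ -9 ∧ 1 < ‖(W.j : ℚ_[q])‖ := by
  obtain ⟨f, -, -, -, C, hC⟩ := exists_kubertTate_nine_of_addOrderOf_eq_nine W hP
  obtain ⟨q, hq, -, hv, hn⟩ := exists_prime_one_lt_norm_j_of_smul_eq_kubertTate_nine hC
  exact ⟨q, hq, hv, hn⟩

variable (W) in
/-- **An elliptic curve over `ℚ` with a rational point of order `9` has no complex multiplication.**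
(CM curves over `ℚ` have integral `j`; consistent with the CM torsion table — CM torsion over `ℚ` has order
`≤ 6` — which is not used.) [cite: SilvermanATAEC1994, Thm. II.6.1] [cite: SilvermanAEC2009, App. C §11]
[cite: Kubert1976, Table 3 (N = 9)] -/
theorem not_hasCM_of_addOrderOf_eq_nine {P : W.toAffine.Point} (hP : addOrderOf P = 9) : ¬ W.HasCM := by
  obtain ⟨q, hq, -, hnorm⟩ := exists_prime_one_lt_norm_j_of_addOrderOf_eq_nine W hP
  exact not_hasCM_of_one_lt_norm_j W hnorm

end JInvariant

end WeierstrassCurve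

end
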